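import Summits.QuantumFields.YangMills.Theorems.IsotropyFromPowerCountingTemperedCurvatureMomentsThreePointChartBoundsStandard

/-!
# Three-point chart bounds VI: lattice frames

Support file for stub `stub_threePointChartBounds` (B) of reshape 4 of
`Cruxes/TemperedCurvatureMoments/Lines/Sketch.lean` (crux stmt-QuantumFields-17721, line `Sketch`).
Every frame `(n, v)` of the menu is `(R e₀, R e₁)` for an isometry `R`; for `𝔖` invariant under proper signed
permutations on `⁰𝒮` and reflection positive in the eight planar frames, `𝔖 ∘ linActMulti Q` is reflection
positive for every `Q` with `Q e₀` a planar lattice direction; hence the pulled-back family of a frame has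
`OSReconstructionNoE1`, eight-frame reflection positivity, E0', E3, and joint spectral measures on the planar
cone (`planarConeSupport_of_parts` of crux `PlanarSpectralCone` with its landed stubs); temperedness bounds
transfer with the same constants.
References: Osterwalder–Schrader, Comm. Math. Phys. 31 (1973) §4.1, 42 (1975) §4; Glimm–Jaffe, Quantum
Physics (1987) Thm. 6.1.3, §19.5. [folklore]
-/

noncomputable section

open scoped InnerProductSpace ComplexConjugate
open MeasureTheory Filter Set Complex
open _root_.Topology
open Literature.MathematicalPhysics.AQFT Literature.MathematicalPhysics.QuantumLattice
open Literature.MathematicalPhysics.QuantumFieldTheory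
open scoped SchwartzMap LineDeriv
open Literature.MathematicalPhysics.QuantumLattice.SchwingerFamily (timeVec)
open Summit.QuantumFields.YangMills.Theorems.CurvatureKernel
open Summit.QuantumFields.YangMills.Cruxes.PlanarSpectralCone.TwoMirrorLightconeSlots.DiscSections (translateMulti_time_space)

namespace Summit.QuantumFields.YangMills.Theorems.TemperedCurvatureMoments.Sketch.ThreePointChartBounds

/-! ## Lattice frames: isometries, reflection positivity, cone support, temperedness of the pulled-back family -/

section Frames

open Summit.QuantumFields.YangMills.Theorems.CurvatureBoostCovariance.Negative
  (OSPackage Translations Hypercubic EightFrameRP)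

/-- **The `45°` frame with both planar columns**: `R e₀ = (e₀ + e₁)/√2`, `R e₁ = (e₀ − e₁)/√2`. [folklore] -/
theorem exists_diagonal_frame₂ :
    ∃ R : EuclideanSpace ℝ (Fin 4) ≃ₗᵢ[ℝ] EuclideanSpace ℝ (Fin 4),
      R (EuclideanSpace.single 0 1) =
        Real.sqrt (1 / 2) • EuclideanSpace.single 0 1 + Real.sqrt (1 / 2) • EuclideanSpace.single 1 1 ∧
      R (EuclideanSpace.single 1 1) =
        Real.sqrt (1 / 2) • EuclideanSpace.single 0 1 - Real.sqrt (1 / 2) • EuclideanSpace.single 1 1 := by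
  -- adapted from `CurvatureKernel.exists_diagonal_frame`
  set c : ℝ := Real.sqrt (1 / 2) with hcdef
  have hc : c * c = 1 / 2 := Real.mul_self_sqrt (by norm_num)
  let v : Fin 4 → EuclideanSpace ℝ (Fin 4) :=
    ![c • EuclideanSpace.single 0 1 + c • EuclideanSpace.single 1 1,
      c • EuclideanSpace.single 0 1 - c • EuclideanSpace.single 1 1,
      EuclideanSpace.single 2 1, EuclideanSpace.single 3 1]
  have hv : Orthonormal ℝ v := by
    rw [orthonormal_iff_ite]
    intro i j
    fin_cases i <;> fin_cases j <;>
      simp only [v, Fin.zero_eta, Fin.mk_one, Fin.reduceFinMk, Fin.isValue, Matrix.cons_val,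
        Matrix.cons_val_zero, Matrix.cons_val_one, inner_add_left, inner_add_right, inner_sub_left,
        inner_sub_right, inner_smul_left, inner_smul_right, EuclideanSpace.inner_single_right,
        PiLp.single_apply, conj_trivial, Fin.reduceEq, if_true, if_false] <;>
      norm_num <;> linarith [hc]
  obtain ⟨R, hR⟩ := exists_linearIsometryEquiv_apply_single_eq hv
  exact ⟨R, by rw [hR]; rfl, by rw [hR]; rfl⟩

/-- Every frame of the menu is `(R e₀, R e₁)` for a linear isometry `R` of `ℝ⁴`. [folklore] -/
theorem exists_isometry_of_frameCond {n v : EuclideanSpace ℝ (Fin 4)} (hnv : ((∃ (μ ν : Fin 4) (s s' : ℝ), μ ≠ ν ∧ (s = 1 ∨ s = -1) ∧ (s' = 1 ∨ s' = -1) ∧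
    n = s • (EuclideanSpace.single μ (1 : ℝ) : EuclideanSpace ℝ (Fin 4)) ∧
    v = s' • (EuclideanSpace.single ν (1 : ℝ) : EuclideanSpace ℝ (Fin 4))) ∨
  (∃ (μ ν : Fin 4) (s s' : ℝ), μ ≠ ν ∧ (s = 1 ∨ s = -1) ∧ (s' = 1 ∨ s' = -1) ∧
    n = (Real.sqrt 2)⁻¹ • (s • (EuclideanSpace.single μ (1 : ℝ) : EuclideanSpace ℝ (Fin 4)) +
      s' • (EuclideanSpace.single ν (1 : ℝ) : EuclideanSpace ℝ (Fin 4))) ∧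
    v = (Real.sqrt 2)⁻¹ • (s • (EuclideanSpace.single μ (1 : ℝ) : EuclideanSpace ℝ (Fin 4)) -
      s' • (EuclideanSpace.single ν (1 : ℝ) : EuclideanSpace ℝ (Fin 4)))))) :
    ∃ R : EuclideanSpace ℝ (Fin 4) ≃ₗᵢ[ℝ] EuclideanSpace ℝ (Fin 4),
      R (EuclideanSpace.single 0 1) = n ∧ R (EuclideanSpace.single 1 1) = v := by
  rcases hnv with ⟨μ, ν, s, s', hμν, hs, hs', rfl, rfl⟩ | ⟨μ, ν, s, s', hμν, hs, hs', rfl, rfl⟩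
  · obtain ⟨P, -, -, h0, h1⟩ := exists_signedPerm_frame μ ν hμν hs hs'
    exact ⟨P, h0, h1⟩
  · obtain ⟨R₀, hR₀, hR₁⟩ := exists_diagonal_frame₂
    obtain ⟨P, -, -, h0, h1⟩ := exists_signedPerm_frame μ ν hμν hs hs'
    have hc : Real.sqrt (1 / 2) = (Real.sqrt 2)⁻¹ := by rw [one_div, Real.sqrt_inv]
    refine ⟨R₀.trans P, ?_, ?_⟩
    · rw [LinearIsometryEquiv.trans_apply, hR₀, map_add, LinearIsometryEquiv.map_smul,
        LinearIsometryEquiv.map_smul, h0, h1, hc, smul_add]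
    · rw [LinearIsometryEquiv.trans_apply, hR₁, map_sub, LinearIsometryEquiv.map_smul,
        LinearIsometryEquiv.map_smul, h0, h1, hc, smul_sub]

/-- **Planar lattice directions of a frame**: for a frame `(n, v)` of the menu and a planar frame type
`(a, b)` (`a² + b² = 1`, `a = 0 ∨ b = 0 ∨ a² = b²`), the direction `a n + b v` is again of planar frame
type in a coordinate plane: `a n + b v = a' e_μ + b' e_ν`. [folklore] -/
theorem frameCond_dir {n v : EuclideanSpace ℝ (Fin 4)} (hnv : ((∃ (μ ν : Fin 4) (s s' : ℝ), μ ≠ ν ∧ (s = 1 ∨ s = -1) ∧ (s' = 1 ∨ s' = -1) ∧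
    n = s • (EuclideanSpace.single μ (1 : ℝ) : EuclideanSpace ℝ (Fin 4)) ∧
    v = s' • (EuclideanSpace.single ν (1 : ℝ) : EuclideanSpace ℝ (Fin 4))) ∨
  (∃ (μ ν : Fin 4) (s s' : ℝ), μ ≠ ν ∧ (s = 1 ∨ s = -1) ∧ (s' = 1 ∨ s' = -1) ∧
    n = (Real.sqrt 2)⁻¹ • (s • (EuclideanSpace.single μ (1 : ℝ) : EuclideanSpace ℝ (Fin 4)) +
      s' • (EuclideanSpace.single ν (1 : ℝ) : EuclideanSpace ℝ (Fin 4))) ∧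
    v = (Real.sqrt 2)⁻¹ • (s • (EuclideanSpace.single μ (1 : ℝ) : EuclideanSpace ℝ (Fin 4)) -
      s' • (EuclideanSpace.single ν (1 : ℝ) : EuclideanSpace ℝ (Fin 4)))))) {a b : ℝ}
    (hab : a ^ 2 + b ^ 2 = 1) (h8 : a = 0 ∨ b = 0 ∨ a ^ 2 = b ^ 2) :
    ∃ (μ ν : Fin 4) (a' b' : ℝ), μ ≠ ν ∧ a' ^ 2 + b' ^ 2 = 1 ∧ (a' = 0 ∨ b' = 0 ∨ a' ^ 2 = b' ^ 2) ∧
      a • n + b • v = a' • EuclideanSpace.single μ 1 + b' • EuclideanSpace.single ν 1 := by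
  rcases hnv with ⟨μ, ν, s, s', hμν, hs, hs', rfl, rfl⟩ | ⟨μ, ν, s, s', hμν, hs, hs', rfl, rfl⟩
  · have hs2 : s ^ 2 = 1 := by rcases hs with rfl | rfl <;> norm_num
    have hs'2 : s' ^ 2 = 1 := by rcases hs' with rfl | rfl <;> norm_num
    refine ⟨μ, ν, a * s, b * s', hμν, ?_, ?_, ?_⟩
    · rw [mul_pow, mul_pow, hs2, hs'2, mul_one, mul_one, hab]
    · rcases h8 with h | h | h
      · exact Or.inl (by rw [h, zero_mul])
      · exact Or.inr (Or.inl (by rw [h, zero_mul]))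
      · exact Or.inr (Or.inr (by rw [mul_pow, mul_pow, hs2, hs'2, h]))
    · rw [smul_smul, smul_smul]
  · have hs2 : s ^ 2 = 1 := by rcases hs with rfl | rfl <;> norm_num
    have hs'2 : s' ^ 2 = 1 := by rcases hs' with rfl | rfl <;> norm_num
    set c : ℝ := (Real.sqrt 2)⁻¹ with hcdef
    have hc2 : c ^ 2 = 1 / 2 := by rw [hcdef, inv_pow, Real.sq_sqrt (by norm_num : (0:ℝ) ≤ 2), one_div]
    refine ⟨μ, ν, c * (a + b) * s, c * (a - b) * s', hμν, ?_, ?_, ?_⟩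
    · have : (c * (a + b) * s) ^ 2 + (c * (a - b) * s') ^ 2 = c ^ 2 * 2 * (a ^ 2 + b ^ 2) := by
        rw [mul_pow, mul_pow, mul_pow, mul_pow, hs2, hs'2]; ring
      rw [this, hc2, hab]; norm_num
    · rcases h8 with h | h | h
      · refine Or.inr (Or.inr ?_)
        rw [h, zero_add, zero_sub, mul_pow, mul_pow, mul_pow, mul_pow, hs2, hs'2, neg_sq]
      · refine Or.inr (Or.inr ?_)
        rw [h, add_zero, sub_zero, mul_pow, mul_pow, mul_pow, mul_pow, hs2, hs'2]
      · have hab' : (a + b) * (a - b) = 0 := by nlinarith [h]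
        rcases mul_eq_zero.1 hab' with h1 | h1
        · exact Or.inl (by rw [h1]; ring)
        · exact Or.inr (Or.inl (by rw [h1]; ring))
    · ext i
      simp only [PiLp.add_apply, PiLp.smul_apply, PiLp.sub_apply, PiLp.single_apply, smul_eq_mul]
      ring

variable (S₁ : SchwingerFamily (EuclideanSpace ℝ (Fin 4)))

/-- **Reflection positivity in every planar lattice frame**: for a family invariant under the proper
signed permutations on `⁰𝒮` and reflection positive in the eight planar frames of the `(x₀,x₁)`-plane,
`𝔖 ∘ linActMulti Q` is reflection positive for EVERY isometry `Q` with
`Q e₀ = a e_μ + b e_ν` of planar frame type. [folklore] -/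
theorem isReflectionPositive_latticeFrame (hhyp : Hypercubic S₁) (h8 : EightFrameRP S₁)
    (Q : EuclideanSpace ℝ (Fin 4) ≃ₗᵢ[ℝ] EuclideanSpace ℝ (Fin 4)) {μ ν : Fin 4} (hμν : μ ≠ ν) {a b : ℝ}
    (hab : a ^ 2 + b ^ 2 = 1) (h8t : a = 0 ∨ b = 0 ∨ a ^ 2 = b ^ 2)
    (hQ : Q (EuclideanSpace.single 0 1) = a • EuclideanSpace.single μ 1 + b • EuclideanSpace.single ν 1) :
    (SchwingerFamily.toLabelled (fun m => (S₁ m).comp (linActMulti Q))).IsReflectionPositive := by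
  obtain ⟨P, hdet, hsign, h0, h1⟩ := exists_signedPerm_frame μ ν hμν (Or.inl rfl) (Or.inl rfl)
  rw [one_smul] at h0 h1
  set R := Q.trans P.symm with hR
  have hRe : R (EuclideanSpace.single 0 1) = a • EuclideanSpace.single 0 1 + b • EuclideanSpace.single 1 1 := by
    rw [hR, LinearIsometryEquiv.trans_apply, hQ, map_add, LinearIsometryEquiv.map_smul,
      LinearIsometryEquiv.map_smul, ← h0, ← h1, LinearIsometryEquiv.symm_apply_apply,
      LinearIsometryEquiv.symm_apply_apply]
  have hRP := h8 R a b hab h8t hRe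
  have hQ' : R.trans P = Q := by
    ext x
    simp [hR]
  have key := isReflectionPositive_comp_linActMulti_trans S₁ R P (hhyp P hdet hsign) hRP
  rwa [hQ'] at key

/-- Translation invariance on `⁰𝒮` of the pulled-back family (unbundled form). [folklore] -/
theorem translations_frame (htr : Translations S₁) (R : EuclideanSpace ℝ (Fin 4) ≃ₗᵢ[ℝ] EuclideanSpace ℝ (Fin 4)) :
    ∀ (m : ℕ) (a : EuclideanSpace ℝ (Fin 4)) (F : 𝓢((Fin m → EuclideanSpace ℝ (Fin 4)), ℂ)), IsOffDiagonal F →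
      (fun m => (S₁ m).comp (linActMulti R)) m (translateMulti a F) = (fun m => (S₁ m).comp (linActMulti R)) m F :=
  fun m a F hF => isTranslationInvariant_toLabelled_comp_linActMulti S₁ R htr m (fun _ => ()) a F hF

/-- The diagonal action of an isometry on `(ℝ⁴)ᴺ` (sup norm) has operator norm `≤ 1`. [folklore] -/
theorem norm_piCongrRight_le' {N : ℕ} (L : EuclideanSpace ℝ (Fin 4) ≃ₗᵢ[ℝ] EuclideanSpace ℝ (Fin 4)) :
    ‖((ContinuousLinearEquiv.piCongrRight fun _ : Fin N => L.toContinuousLinearEquiv :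
        (Fin N → EuclideanSpace ℝ (Fin 4)) ≃L[ℝ] (Fin N → EuclideanSpace ℝ (Fin 4))) :
        (Fin N → EuclideanSpace ℝ (Fin 4)) →L[ℝ] (Fin N → EuclideanSpace ℝ (Fin 4)))‖ ≤ 1 := by
  -- adapted from `BoostsInheritMirrors.RayPositivity.norm_piCongrRight_le`
  refine ContinuousLinearMap.opNorm_le_bound _ zero_le_one fun x => ?_
  rw [one_mul, pi_norm_le_iff_of_nonneg (norm_nonneg x)]
  intro i
  calc ‖((ContinuousLinearEquiv.piCongrRight fun _ : Fin N => L.toContinuousLinearEquiv :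
          (Fin N → EuclideanSpace ℝ (Fin 4)) ≃L[ℝ] (Fin N → EuclideanSpace ℝ (Fin 4))) :
          (Fin N → EuclideanSpace ℝ (Fin 4)) →L[ℝ] (Fin N → EuclideanSpace ℝ (Fin 4))) x i‖ = ‖L (x i)‖ := rfl
    _ = ‖x i‖ := L.norm_map _
    _ ≤ ‖x‖ := norm_le_pi_norm x i

/-- **Schwartz norms are not increased by the diagonal action of an isometry.** [folklore] -/
theorem schwartzNorm_linActMulti_le' {N : ℕ} (L : EuclideanSpace ℝ (Fin 4) ≃ₗᵢ[ℝ] EuclideanSpace ℝ (Fin 4)) (M : ℕ)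
    (X : 𝓢((Fin N → EuclideanSpace ℝ (Fin 4)), ℂ)) :
    schwartzNorm M (linActMulti L X) ≤ schwartzNorm M X := by
  -- adapted from `BoostsInheritMirrors.RayPositivity.schwartzNorm_linActMulti_le`
  have h := NuclearExpansion.schwartzNorm_compCLMOfContinuousLinearEquiv_le M
    (ContinuousLinearEquiv.piCongrRight fun _ : Fin N => L.symm.toContinuousLinearEquiv :
      (Fin N → EuclideanSpace ℝ (Fin 4)) ≃L[ℝ] (Fin N → EuclideanSpace ℝ (Fin 4))) X
  have hsymm : ((ContinuousLinearEquiv.piCongrRight fun _ : Fin N => L.symm.toContinuousLinearEquiv :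
      (Fin N → EuclideanSpace ℝ (Fin 4)) ≃L[ℝ] (Fin N → EuclideanSpace ℝ (Fin 4))).symm :
      (Fin N → EuclideanSpace ℝ (Fin 4)) →L[ℝ] (Fin N → EuclideanSpace ℝ (Fin 4))) =
      ((ContinuousLinearEquiv.piCongrRight fun _ : Fin N => L.toContinuousLinearEquiv :
        (Fin N → EuclideanSpace ℝ (Fin 4)) ≃L[ℝ] (Fin N → EuclideanSpace ℝ (Fin 4))) :
        (Fin N → EuclideanSpace ℝ (Fin 4)) →L[ℝ] (Fin N → EuclideanSpace ℝ (Fin 4))) := by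
    ext x i; rfl
  rw [hsymm, max_eq_left (max_le (norm_piCongrRight_le' L) (norm_piCongrRight_le' L.symm)),
    one_pow, one_mul] at h
  exact h

/-- E0' of the pulled-back family. [folklore] -/
theorem hasLinearGrowth_frame (hlg : S₁.toLabelled.HasLinearGrowth)
    (R : EuclideanSpace ℝ (Fin 4) ≃ₗᵢ[ℝ] EuclideanSpace ℝ (Fin 4)) :
    (SchwingerFamily.toLabelled (fun m => (S₁ m).comp (linActMulti R))).HasLinearGrowth := by
  intro T
  obtain ⟨s, α, β, hαβ⟩ := hlg T
  refine ⟨s, max α 0, β, fun n k hk F hF => ?_⟩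
  have h1 := hαβ n k hk (linActMulti R F) (isOffDiagonal_linActMulti R hF)
  simp only [SchwingerFamily.toLabelled_apply, ContinuousLinearMap.comp_apply] at h1 ⊢
  have h2 : 0 ≤ ((n.factorial : ℝ)) ^ β := by positivity
  calc ‖S₁ n (linActMulti R F)‖ ≤ α * (n.factorial : ℝ) ^ β * schwartzNorm (n * s) (linActMulti R F) := h1
    _ ≤ max α 0 * (n.factorial : ℝ) ^ β * schwartzNorm (n * s) (linActMulti R F) := by
        gcongr
        · exact schwartzNorm_nonneg _ _
        · exact le_max_left _ _
    _ ≤ max α 0 * (n.factorial : ℝ) ^ β * schwartzNorm (n * s) F :=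
        mul_le_mul_of_nonneg_left (schwartzNorm_linActMulti_le' R _ F) (mul_nonneg (le_max_right _ _) h2)

/-- `linActMulti` commutes with permutations of the slots. [folklore] -/
theorem linActMulti_permTest' {m : ℕ} (R : EuclideanSpace ℝ (Fin 4) ≃ₗᵢ[ℝ] EuclideanSpace ℝ (Fin 4))
    (π : Equiv.Perm (Fin m)) (F : 𝓢((Fin m → EuclideanSpace ℝ (Fin 4)), ℂ)) :
    linActMulti R (permTest π F) = permTest π (linActMulti R F) := by
  ext x
  rw [linActMulti_apply, permTest_apply, permTest_apply, linActMulti_apply]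
  rfl

/-- E3 of the pulled-back family. [folklore] -/
theorem isSymmetric_frame (hsym : S₁.toLabelled.IsSymmetric)
    (R : EuclideanSpace ℝ (Fin 4) ≃ₗᵢ[ℝ] EuclideanSpace ℝ (Fin 4)) :
    (SchwingerFamily.toLabelled (fun m => (S₁ m).comp (linActMulti R))).IsSymmetric := by
  intro n k π F hF
  have h1 := hsym n k π (linActMulti R F) (isOffDiagonal_linActMulti R hF)
  simp only [SchwingerFamily.toLabelled_apply, ContinuousLinearMap.comp_apply] at h1 ⊢
  rw [linActMulti_permTest', h1]

/-- E3 of the pulled-back family, unbundled in degree `m`. [folklore] -/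
theorem permTest_frame (hsym : S₁.toLabelled.IsSymmetric)
    (R : EuclideanSpace ℝ (Fin 4) ≃ₗᵢ[ℝ] EuclideanSpace ℝ (Fin 4)) {m : ℕ} (π : Equiv.Perm (Fin m))
    (F : 𝓢((Fin m → EuclideanSpace ℝ (Fin 4)), ℂ)) (hF : IsOffDiagonal F) :
    (fun m => (S₁ m).comp (linActMulti R)) m (permTest π F) = (fun m => (S₁ m).comp (linActMulti R)) m F := by
  have := isSymmetric_frame S₁ hsym R m (fun _ => ()) π F hF
  simpa only [SchwingerFamily.toLabelled_apply] using this

/-- Temperedness bounds transfer to the pulled-back family with the same constants (`C ≥ 0`). [folklore] -/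
theorem bound_frame (R : EuclideanSpace ℝ (Fin 4) ≃ₗᵢ[ℝ] EuclideanSpace ℝ (Fin 4)) {m M : ℕ} {C : ℝ} (hC : 0 ≤ C)
    (hS : ∀ F, ‖S₁ m F‖ ≤ C * schwartzNorm M F) :
    ∀ F, ‖(fun m => (S₁ m).comp (linActMulti R)) m F‖ ≤ C * schwartzNorm M F := fun F =>
  (hS _).trans (mul_le_mul_of_nonneg_left (schwartzNorm_linActMulti_le' R M F) hC)

/-- **The OS package of a lattice frame.**  For `S₁` with the OS package, translations, proper signed
permutations and eight-frame reflection positivity, and a frame `(n, v) = (R e₀, R e₁)` of the menu, the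
pulled-back family `𝔖 ∘ linActMulti R` has E2 and translations on `⁰𝒮` (`OSReconstructionNoE1`), its
joint spectral measures are carried by the closed planar cone (crux `PlanarSpectralCone`, support form,
through `planarConeSupport_of_parts` and the landed stubs of that line), and it is E3-symmetric. [folklore] -/
theorem frame_package (hpkg : OSPackage S₁) (htr : Translations S₁) (hhyp : Hypercubic S₁) (h8 : EightFrameRP S₁)
    {n v : EuclideanSpace ℝ (Fin 4)} (hnv : ((∃ (μ ν : Fin 4) (s s' : ℝ), μ ≠ ν ∧ (s = 1 ∨ s = -1) ∧ (s' = 1 ∨ s' = -1) ∧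
    n = s • (EuclideanSpace.single μ (1 : ℝ) : EuclideanSpace ℝ (Fin 4)) ∧
    v = s' • (EuclideanSpace.single ν (1 : ℝ) : EuclideanSpace ℝ (Fin 4))) ∨
  (∃ (μ ν : Fin 4) (s s' : ℝ), μ ≠ ν ∧ (s = 1 ∨ s = -1) ∧ (s' = 1 ∨ s' = -1) ∧
    n = (Real.sqrt 2)⁻¹ • (s • (EuclideanSpace.single μ (1 : ℝ) : EuclideanSpace ℝ (Fin 4)) +
      s' • (EuclideanSpace.single ν (1 : ℝ) : EuclideanSpace ℝ (Fin 4))) ∧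
    v = (Real.sqrt 2)⁻¹ • (s • (EuclideanSpace.single μ (1 : ℝ) : EuclideanSpace ℝ (Fin 4)) -
      s' • (EuclideanSpace.single ν (1 : ℝ) : EuclideanSpace ℝ (Fin 4))))))
    (R : EuclideanSpace ℝ (Fin 4) ≃ₗᵢ[ℝ] EuclideanSpace ℝ (Fin 4))
    (hR0 : R (EuclideanSpace.single 0 1) = n) (hR1 : R (EuclideanSpace.single 1 1) = v) :
    ∃ hR : OSReconstructionNoE1 (SchwingerFamily.toLabelled (fun m => (S₁ m).comp (linActMulti R))),
      (∀ (ψ : hR.Hilbert) (μ : Measure (EuclideanSpace ℝ (Fin 4))),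
        hR.IsJointSpectralMeasure ψ μ → μ {p | p 0 < |p 1|} = 0) := by
  -- reflection positivity of the frame itself: `R e₀ = 1 • n + 0 • v`
  have hframes : ∀ (R' : EuclideanSpace ℝ (Fin 4) ≃ₗᵢ[ℝ] EuclideanSpace ℝ (Fin 4)) (a b : ℝ),
      a ^ 2 + b ^ 2 = 1 → (a = 0 ∨ b = 0 ∨ a ^ 2 = b ^ 2) →
      R' (EuclideanSpace.single 0 1) = a • EuclideanSpace.single 0 1 + b • EuclideanSpace.single 1 1 →
      (SchwingerFamily.toLabelled (fun m => ((fun m => (S₁ m).comp (linActMulti R)) m).comp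
        (linActMulti R'))).IsReflectionPositive := by
    intro R' a b hab h8t hR'
    obtain ⟨μ, ν, a', b', hμν, hab', h8t', hdir⟩ := frameCond_dir hnv hab h8t
    have hfam : (fun m => ((fun m => (S₁ m).comp (linActMulti R)) m).comp (linActMulti R')) =
        fun m => (S₁ m).comp (linActMulti (R'.trans R)) := by
      funext m
      ext F
      simp only [ContinuousLinearMap.comp_apply, linActMulti_trans]
    rw [hfam]
    refine isReflectionPositive_latticeFrame S₁ hhyp h8 (R'.trans R) hμν hab' h8t' ?_
    rw [LinearIsometryEquiv.trans_apply, hR', map_add, LinearIsometryEquiv.map_smul,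
      LinearIsometryEquiv.map_smul, hR0, hR1, hdir]
  have hRP : (SchwingerFamily.toLabelled (fun m => (S₁ m).comp (linActMulti R))).IsReflectionPositive := by
    have h1 := hframes (LinearIsometryEquiv.refl ℝ _) 1 0 (by norm_num) (Or.inr (Or.inl rfl)) (by simp)
    have hfam : (fun m => ((fun m => (S₁ m).comp (linActMulti R)) m).comp
        (linActMulti (LinearIsometryEquiv.refl ℝ (EuclideanSpace ℝ (Fin 4))))) =
        fun m => (S₁ m).comp (linActMulti R) := by
      funext m
      ext F
      simp only [ContinuousLinearMap.comp_apply]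
      congr 1
    rwa [hfam] at h1
  have hR : OSReconstructionNoE1 (SchwingerFamily.toLabelled (fun m => (S₁ m).comp (linActMulti R))) :=
    ⟨hRP, isTranslationInvariant_toLabelled_comp_linActMulti S₁ R htr⟩
  refine ⟨hR, ?_⟩
  exact Summit.QuantumFields.YangMills.Cruxes.PlanarSpectralCone.PositivityDiscToOperatorCone.planarConeSupport_of_parts
    Summit.QuantumFields.YangMills.Cruxes.PlanarSpectralCone.PositivityDiscToOperatorCone.stub_discSections
    Summit.QuantumFields.YangMills.Cruxes.PlanarSpectralCone.PositivityDiscToOperatorCone.stub_cone_of_discSections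
    Summit.QuantumFields.YangMills.Cruxes.PlanarSpectralCone.PositivityDiscToOperatorCone.stub_density
    Summit.QuantumFields.YangMills.Cruxes.PlanarSpectralCone.PositivityDiscToOperatorCone.stub_linearity
    (fun m => (S₁ m).comp (linActMulti R)) (hasLinearGrowth_frame S₁ hpkg.2.2.1 R)
    (isSymmetric_frame S₁ hpkg.2.2.2.2.1 R) (translations_frame S₁ htr R) hframes hR

/-! ### Pulling test functions back to the frame -/

/-- `linActMulti R ((a ∘ R) ⊗ (b ∘ R) ⊗ (c ∘ R)) = a ⊗ b ⊗ c`. [folklore] -/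
theorem linActMulti_tensorFin_three_comp (R : EuclideanSpace ℝ (Fin 4) ≃ₗᵢ[ℝ] EuclideanSpace ℝ (Fin 4))
    (a b c : 𝓢(EuclideanSpace ℝ (Fin 4), ℂ)) :
    linActMulti R (SchwartzMap.tensorFin 3
        ![SchwartzMap.compCLMOfContinuousLinearEquiv ℂ R.toContinuousLinearEquiv a,
          SchwartzMap.compCLMOfContinuousLinearEquiv ℂ R.toContinuousLinearEquiv b,
          SchwartzMap.compCLMOfContinuousLinearEquiv ℂ R.toContinuousLinearEquiv c]) =
      SchwartzMap.tensorFin 3 ![a, b, c] := by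
  ext x
  rw [linActMulti_apply, tensorFin_three_eval, tensorFin_three_eval]
  simp

end Frames

end Summit.QuantumFields.YangMills.Theorems.TemperedCurvatureMoments.Sketch.ThreePointChartBounds

end
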